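import Summits.Ventures.CertifiedManyBodySolver.Downfold.PressureContinuumRecord
import HarnessLib

/-!
# The TEMPERATURE axis of the P-continuum record: T-sliced records, T-independence of computed
# columns, and the first typed TEMPERATURE-SPLIT record (La₃Ni₂O₇, VSET-v1 M23)

Venture CertifiedManyBodySolver, cell `pub/hubbard-downfold` (S1 = downfolding front end = ROUTER),
seat hubbard-downfold-mod-2; namespace `Summit.Ventures.CertifiedManyBodySolver.Downfold.PCont`.
The phase map of D-0098/D-0099 is indexed by `T × P × H`. The router WORD at a computed pressure is a
ground-state (static-lattice DFT) word and does not depend on the map temperature; but the STRUCTURE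
ENTRY of record does (§P.12(h) reads the printed transition «at the cell temperature of the truth
column»), so an open P-interval can be decided at one temperature and withheld at another:
`router/P-INTERVALS.md` carries two TEMPERATURE-SPLIT rows (La₃Ni₂O₇ M23 (0,15): «undetermined» at RT
— Amam → Fmmm P* ∈ [10, 15] GPa inside — but «UND:MULTIORB(k=2) — interpolated» at ≤ 100 K where both
end cells are Fmmm; (15,20): interpolated at RT, «undetermined» at ≤ 80 K — Fmmm → I4/mmm P* ∈ [15.7,
19.6] GPa @40 K inside). `PressureContinuumRecord.Rec` has no temperature argument. This file adds it:

* §1 `TRec π ω τ`: computed pressures + T-independent column words `cw`, T-DEPENDENT gap words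
  `gw : π → τ → Option ω` and reach words `rw : π → τ → Option ω`; `slice t : Rec π ω` and
  `lookup t P := (slice t).lookup P`. PROVED: every KERNEL-IV statement transfers slice-wise
  (`lookup_slice`); **computed items are T-INDEPENDENT** (`lookup_of_mem`, `kind_eq_computed_iff`,
  `lookup_eq_of_mem` — the item at a computed pressure is the same at every temperature); the class
  «screening» is T-independent (`conf_eq_screening_iff`); a gap decided at temperature `t` carries
  its word over the CLOSED gap at that temperature (`word_eq_on_gap_of_decidedAt`) with class
  «interpolated» strictly inside (`conf_of_mem_gap_of_decidedAt`); a gap undetermined at `t` carries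
  no word strictly inside at `t` (`no_word_of_undeterminedAt`); hence **a TEMPERATURE-SPLIT gap
  yields, at one interior pressure, a worded item at one temperature and a word-free item at the
  other** (`split_gap_items`) — the `T × P` cell semantics the score pens asked for.
* §2 THE TYPED La₃Ni₂O₇ RECORD (`la327Rec`; pressures in GPa as `ℕ`: columns 0 / 15 / 20 / 30, all
  worded `MULTIORB` = «UND:MULTIORB(k=2: x²−y², z²; J_H)»; temperature regimes `RT` / `lowT` (≤ 100 K
  on (0,15), ≤ 80 K on (15,20) — merged, stated); gap words of record: (0,15) RT none / lowT some,
  (15,20) RT some / lowT none, (20,30) some at both; no reaches) with `decide`-checked items: at 10 GPa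
  no word at RT but MULTIORB at low T; at 17 GPa the reverse; at 25 GPa MULTIORB at both; columns
  «screening» at both temperatures; the closed-gap transfer `la327_word_on_0_15_lowT` /
  `la327_word_on_15_20_RT` / `la327_word_on_20_30` and the withholdings `la327_no_word_inside_0_15_RT` /
  `la327_no_word_inside_15_20_lowT`.

Everything is PROVED (definitional unfolding + KERNEL IV + `decide`). WHAT THIS IS NOT: a new reading
of La₃Ni₂O₇ (the rows are `router/P-INTERVALS.tsv` M23 as of v0.28–v0.33); not a certified statement
about the material (words are SCREENING-GRADE abstentions «UND:MULTIORB»; the structure brackets are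
[float] literature statements, REFVALS-3 §7); not a claim that router words themselves vary with T.
-/

namespace Summit.Ventures.CertifiedManyBodySolver.Downfold

namespace PCont

/-! ## §1 T-sliced records -/

/-- **The P-continuum record with a TEMPERATURE argument**: computed pressures `pts` with
T-independent words `cw`; the gap word `gw a t` of the open gap right of the computed pressure `a` AT
map temperature `t` (`none` = undetermined there); the reach word `rw P t`. [folklore] -/
structure TRec (π ω τ : Type*) where
  /-- the computed pressures (columns of record) -/
  pts : Finset π
  /-- the word of record at a computed pressure (T-independent) -/
  cw : π → ω
  /-- the interval word of the open gap right of a computed pressure, at temperature `t` -/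
  gw : π → τ → Option ω
  /-- the reach word covering a pressure, at temperature `t` -/
  rw : π → τ → Option ω

namespace TRec

section Slice

variable {π ω τ : Type*} (R : TRec π ω τ)

/-- The T-slice of the record: an ordinary `Rec` (KERNEL IV applies to it verbatim). [folklore] -/
def slice (t : τ) : Rec π ω where
  pts := R.pts
  cw := R.cw
  gw := fun P => R.gw P t
  rw := fun P => R.rw P t

/-- The slice has the same computed pressures. [folklore] -/
@[simp] theorem slice_pts (t : τ) : (R.slice t).pts = R.pts := rfl

/-- The slice has the same column words. [folklore] -/
@[simp] theorem slice_cw (t : τ) : (R.slice t).cw = R.cw := rfl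

/-- The slice's gap word is the T-dependent gap word at `t`. [folklore] -/
@[simp] theorem slice_gw (t : τ) (P : π) : (R.slice t).gw P = R.gw P t := rfl

/-- The slice's reach word is the T-dependent reach word at `t`. [folklore] -/
@[simp] theorem slice_rw (t : τ) (P : π) : (R.slice t).rw P = R.rw P t := rfl

end Slice

variable {π ω τ : Type*} [LinearOrder π] (R : TRec π ω τ)

/-- The `by_P` item at pressure `P` and map temperature `t`. [folklore] -/
def lookup (t : τ) (P : π) : Item ω := (R.slice t).lookup P

/-- `lookup t P` IS the KERNEL-IV lookup of the `t`-slice (definitional). [folklore] -/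
theorem lookup_slice (t : τ) (P : π) : R.lookup t P = (R.slice t).lookup P := rfl

/-- **COMPUTED ITEMS ARE T-INDEPENDENT**: at a computed pressure the item is «computed» with the
column word, whatever the map temperature. [folklore] -/
theorem lookup_of_mem {P : π} (h : P ∈ R.pts) (t : τ) :
    R.lookup t P = ⟨.computed, some (R.cw P)⟩ :=
  (R.slice t).lookup_of_mem h

/-- … hence two temperatures give the SAME item at a computed pressure. [folklore] -/
theorem lookup_eq_of_mem {P : π} (h : P ∈ R.pts) (t t' : τ) : R.lookup t P = R.lookup t' P := by
  rw [R.lookup_of_mem h t, R.lookup_of_mem h t']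

/-- An item is «computed» iff its pressure is a computed column — at every temperature (the join
never manufactures a computed cell on the T axis either). [folklore] -/
theorem kind_eq_computed_iff (t : τ) (P : π) : (R.lookup t P).kind = .computed ↔ P ∈ R.pts :=
  (R.slice t).kind_eq_computed_iff P

/-- The class «screening» is carried exactly at the computed columns, at every temperature.
[folklore] -/
theorem conf_eq_screening_iff (t : τ) (P : π) : (R.lookup t P).conf = .screening ↔ P ∈ R.pts :=
  (R.slice t).conf_eq_screening_iff P

/-- Consecutive computed pressures (T-independent). [folklore] -/
def Consecutive (a b : π) : Prop :=
  a ∈ R.pts ∧ b ∈ R.pts ∧ a < b ∧ ∀ c ∈ R.pts, ¬(a < c ∧ c < b)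

/-- The gap `(a, b)` is DECIDED with word `w` AT TEMPERATURE `t`: consecutive columns both worded `w`
and the gap word at `t` is `w`. [folklore] -/
def DecidedAt (t : τ) (a b : π) (w : ω) : Prop :=
  R.Consecutive a b ∧ R.gw a t = some w ∧ R.cw a = w ∧ R.cw b = w

/-- `Consecutive` is the slice's `Consecutive`. [folklore] -/
theorem consecutive_iff_slice (t : τ) (a b : π) :
    R.Consecutive a b ↔ (R.slice t).Consecutive a b := Iff.rfl

/-- `DecidedAt t` is the slice's `Decided`. [folklore] -/
theorem decidedAt_iff_slice (t : τ) (a b : π) (w : ω) :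
    R.DecidedAt t a b w ↔ (R.slice t).Decided a b w := Iff.rfl

/-- **Words extend across a gap decided at `t`, at `t`**: every pressure of the CLOSED gap `[a, b]`
carries `w` at temperature `t` (no reach inside at `t`). [folklore] -/
theorem word_eq_on_gap_of_decidedAt {t : τ} {a b : π} {w : ω} (hd : R.DecidedAt t a b w)
    (hr : ∀ P, a < P → P < b → R.rw P t = none) {P : π} (haP : a ≤ P) (hPb : P ≤ b) :
    (R.lookup t P).word = some w :=
  (R.slice t).word_eq_on_gap_of_decided ((R.decidedAt_iff_slice t a b w).1 hd) hr haP hPb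

/-- … with class «interpolated» strictly inside. [folklore] -/
theorem conf_of_mem_gap_of_decidedAt {t : τ} {a b : π} {w : ω} (hd : R.DecidedAt t a b w)
    (hr : ∀ P, a < P → P < b → R.rw P t = none) {P : π} (haP : a < P) (hPb : P < b) :
    (R.lookup t P).conf = .interpolated :=
  (R.slice t).conf_lookup_of_mem_gap ((R.decidedAt_iff_slice t a b w).1 hd) hr haP hPb

/-- **A gap undetermined at `t` carries no word strictly inside, at `t`.** [folklore] -/
theorem no_word_of_undeterminedAt {t : τ} {a b P : π} (hc : R.Consecutive a b)
    (hgw : R.gw a t = none) (hr : R.rw P t = none) (haP : a < P) (hPb : P < b) :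
    (R.lookup t P).word = none ∧ (R.lookup t P).conf = .none :=
  (R.slice t).word_lookup_of_undetermined ((R.consecutive_iff_slice t a b).1 hc) hgw hr haP hPb

/-- **TEMPERATURE-SPLIT GAP ⇒ T-DEPENDENT ITEM AT ONE PRESSURE**: a gap `(a, b)` decided with `w` at
`t₁` and undetermined at `t₂` gives, at every interior pressure, a worded «interpolated» item at `t₁`
and a word-free item at `t₂` — while the two bracketing columns are the same «screening» items at
both temperatures. [folklore] -/
theorem split_gap_items {t₁ t₂ : τ} {a b P : π} {w : ω} (hd : R.DecidedAt t₁ a b w)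
    (hu : R.gw a t₂ = none) (hr₁ : ∀ Q, a < Q → Q < b → R.rw Q t₁ = none) (hr₂ : R.rw P t₂ = none)
    (haP : a < P) (hPb : P < b) :
    (R.lookup t₁ P).word = some w ∧ (R.lookup t₁ P).conf = .interpolated ∧
      (R.lookup t₂ P).word = none ∧ (R.lookup t₂ P).conf = .none ∧
      R.lookup t₁ a = R.lookup t₂ a ∧ R.lookup t₁ b = R.lookup t₂ b := by
  obtain ⟨hw₂, hc₂⟩ := R.no_word_of_undeterminedAt hd.1 hu hr₂ haP hPb
  exact ⟨R.word_eq_on_gap_of_decidedAt hd hr₁ haP.le hPb.le, R.conf_of_mem_gap_of_decidedAt hd hr₁ haP hPb,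
    hw₂, hc₂, R.lookup_eq_of_mem hd.1.1 t₁ t₂, R.lookup_eq_of_mem hd.1.2.1 t₁ t₂⟩

end TRec

/-! ## §2 The typed La₃Ni₂O₇ (M23) record — the first TEMPERATURE-SPLIT record of record -/

/-- Router word tokens of record for the La₃Ni₂O₇ columns (annotations dropped). [folklore] -/
inductive La327Word
  /-- «UND:MULTIORB(k=2: x²−y², z²; J_H)» — the bilayer-nickelate two-orbital abstention (R3b, k = 2) -/
  | MULTIORB
  deriving DecidableEq, Repr

/-- The two map-temperature regimes of the M23 rows of record: room temperature (structure cells as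
printed at RT: Amam below P* ∈ [10, 15] GPa, Fmmm above) and low temperature (≤ 100 K on (0,15),
≤ 80 K on (15,20) — merged into one regime here, stated; the SC truth columns live at T_c ≈ 80 K).
[folklore] -/
inductive Treg
  /-- room temperature (≈ 295 K structure statements) -/
  | RT
  /-- low temperature (≤ 80–100 K structure statements; the SC columns) -/
  | lowT
  deriving DecidableEq, Repr

open La327Word Treg

/-- **The La₃Ni₂O₇ (M23) T × P record of record** (P-INTERVALS v0.28–v0.33; pressures in GPa):
columns {0, 15, 20, 30} all `MULTIORB`; gap (0,15): RT undetermined ((h): Amam → Fmmm P* ∈ [10,15]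
inside) / lowT decided (both end cells Fmmm at ≤ 100 K); gap (15,20): RT decided / lowT undetermined
((h): Fmmm → I4/mmm P* ∈ [15.7, 19.6] GPa @40 K inside); gap (20,30): decided at both; no reaches.
[folklore] -/
def la327Rec : TRec ℕ La327Word Treg where
  pts := {0, 15, 20, 30}
  cw := fun _ => MULTIORB
  gw := fun P t =>
    if P = 0 then (match t with | RT => none | lowT => some MULTIORB)
    else if P = 15 then (match t with | RT => some MULTIORB | lowT => none)
    else if P = 20 then some MULTIORB else none
  rw := fun _ _ => none

/-- At 10 GPa (inside (0,15)): NO word at RT, MULTIORB «interpolated» at low T — one pressure, two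
map temperatures, two different items. [folklore] -/
theorem la327_item_10 :
    (la327Rec.lookup RT 10).word = none ∧ (la327Rec.lookup RT 10).conf = .none ∧
      (la327Rec.lookup lowT 10).word = some MULTIORB ∧
        (la327Rec.lookup lowT 10).conf = .interpolated := by
  decide

/-- At 17 GPa (inside (15,20)): MULTIORB at RT, NO word at low T (the reverse split). [folklore] -/
theorem la327_item_17 :
    (la327Rec.lookup RT 17).word = some MULTIORB ∧ (la327Rec.lookup RT 17).conf = .interpolated ∧
      (la327Rec.lookup lowT 17).word = none ∧ (la327Rec.lookup lowT 17).conf = .none := by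
  decide

/-- At 25 GPa (inside (20,30)): MULTIORB «interpolated» at both temperatures. [folklore] -/
theorem la327_item_25 :
    (la327Rec.lookup RT 25).word = some MULTIORB ∧ (la327Rec.lookup lowT 25).word = some MULTIORB ∧
      (la327Rec.lookup RT 25).conf = .interpolated ∧ (la327Rec.lookup lowT 25).conf = .interpolated := by
  decide

/-- At 40 GPa (beyond the last column): unrouted at both temperatures. [folklore] -/
theorem la327_item_40 :
    (la327Rec.lookup RT 40).kind = .unrouted ∧ (la327Rec.lookup lowT 40).kind = .unrouted := by
  decide

/-- The four columns are «screening» items carrying MULTIORB at BOTH temperatures (T-independence of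
computed items, instances). [folklore] -/
theorem la327_columns (t : Treg) {P : ℕ} (hP : P ∈ ({0, 15, 20, 30} : Finset ℕ)) :
    la327Rec.lookup t P = ⟨.computed, some MULTIORB⟩ :=
  la327Rec.lookup_of_mem hP t

/-- (0,15), (15,20), (20,30) are consecutive column pairs. [folklore] -/
theorem la327_consecutive :
    la327Rec.Consecutive 0 15 ∧ la327Rec.Consecutive 15 20 ∧ la327Rec.Consecutive 20 30 := by
  unfold TRec.Consecutive; decide

/-- (0,15) is DECIDED at low T. [folklore] -/
theorem la327_decided_0_15_lowT : la327Rec.DecidedAt lowT 0 15 MULTIORB := by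
  unfold TRec.DecidedAt TRec.Consecutive; decide

/-- (15,20) is DECIDED at RT. [folklore] -/
theorem la327_decided_15_20_RT : la327Rec.DecidedAt RT 15 20 MULTIORB := by
  unfold TRec.DecidedAt TRec.Consecutive; decide

/-- (20,30) is DECIDED at both temperatures. [folklore] -/
theorem la327_decided_20_30 (t : Treg) : la327Rec.DecidedAt t 20 30 MULTIORB := by
  cases t <;> (unfold TRec.DecidedAt TRec.Consecutive; decide)

/-- No reach anywhere in the record. [folklore] -/
theorem la327_no_reach (P : ℕ) (t : Treg) : la327Rec.rw P t = none := rfl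

/-- **Every pressure of the CLOSED gap [0, 15] GPa carries MULTIORB at low T** (KERNEL IV transferred
to the low-T slice). [folklore] -/
theorem la327_word_on_0_15_lowT {P : ℕ} (h : P ≤ 15) :
    (la327Rec.lookup lowT P).word = some MULTIORB :=
  la327Rec.word_eq_on_gap_of_decidedAt la327_decided_0_15_lowT (fun _ _ _ => rfl) (Nat.zero_le P) h

/-- **… while at RT no pressure strictly inside (0, 15) carries a word.** [folklore] -/
theorem la327_no_word_inside_0_15_RT {P : ℕ} (h₁ : 0 < P) (h₂ : P < 15) :
    (la327Rec.lookup RT P).word = none ∧ (la327Rec.lookup RT P).conf = .none :=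
  la327Rec.no_word_of_undeterminedAt la327_consecutive.1 rfl rfl h₁ h₂

/-- Every pressure of the closed gap [15, 20] carries MULTIORB at RT. [folklore] -/
theorem la327_word_on_15_20_RT {P : ℕ} (h₁ : 15 ≤ P) (h₂ : P ≤ 20) :
    (la327Rec.lookup RT P).word = some MULTIORB :=
  la327Rec.word_eq_on_gap_of_decidedAt la327_decided_15_20_RT (fun _ _ _ => rfl) h₁ h₂

/-- … while at low T no pressure strictly inside (15, 20) carries a word. [folklore] -/
theorem la327_no_word_inside_15_20_lowT {P : ℕ} (h₁ : 15 < P) (h₂ : P < 20) :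
    (la327Rec.lookup lowT P).word = none ∧ (la327Rec.lookup lowT P).conf = .none :=
  la327Rec.no_word_of_undeterminedAt la327_consecutive.2.1 rfl rfl h₁ h₂

/-- Every pressure of the closed gap [20, 30] carries MULTIORB at every temperature. [folklore] -/
theorem la327_word_on_20_30 (t : Treg) {P : ℕ} (h₁ : 20 ≤ P) (h₂ : P ≤ 30) :
    (la327Rec.lookup t P).word = some MULTIORB :=
  la327Rec.word_eq_on_gap_of_decidedAt (la327_decided_20_30 t) (fun _ _ _ => rfl) h₁ h₂

/-- **THE T × P SPLIT AT 10 GPa AS AN INSTANCE OF `split_gap_items`** (decided at low T, undetermined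
at RT; the columns 0 and 15 agree across temperatures). [folklore] -/
theorem la327_split_at_10 :
    (la327Rec.lookup lowT 10).word = some MULTIORB ∧ (la327Rec.lookup lowT 10).conf = .interpolated ∧
      (la327Rec.lookup RT 10).word = none ∧ (la327Rec.lookup RT 10).conf = .none ∧
      la327Rec.lookup lowT 0 = la327Rec.lookup RT 0 ∧ la327Rec.lookup lowT 15 = la327Rec.lookup RT 15 :=
  la327Rec.split_gap_items la327_decided_0_15_lowT rfl (fun _ _ _ => rfl) rfl (by decide) (by decide)

end PCont

end Summit.Ventures.CertifiedManyBodySolver.Downfold
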